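import Summits.QuantumFields.YangMills.Theses.ToronValleyVolume
import Summits.QuantumFields.YangMills.Theorems.VirialFluxGapTauberMeanUpper
import HarnessLib

/-!
# Route `ToronValleyVolume` (YangMills): the support item `TauberMeanUpper` (stmt-QuantumFields-24499) holds BY NAME

`ToronValleyVolume.TauberMeanUpper` (planner ym-idea-4 g15, LINE g15-B «toron-valley volume» → leaf `VirialFluxGap.PeriodicSoftness`
⟨24141⟩; DRAFT by design): the uniform Tauberian mean bound with one slowly varying log factor — on a probability space, a measurable
`F ≥ 0` with `|μ(F ≤ t)/(v t^ρ (e log t⁻¹ + c)) − 1| ≤ κ t^θ` and `e log t⁻¹ + c ≥ ℓ₀ > 0` on `(0,t₀]` satisfies, for `β ≥ 2` with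
`κ((ρ+2)/β)^θ ≤ 1/4` and `64(ρ+2)²(1 + |log v| + |log ℓ₀| + |log t₀| + log β) ≤ βt₀`,
`β ∫F e^{−βF} / ∫e^{−βF} ≤ ρ + (4ρ+5)κ((ρ+2)/β)^θ + 2/β`.  The item's Prop is character-identical (modulo `MeasureTheory.`
qualification) to the tree theorem ✓`VirialFluxGap.TauberMeanUpper.tauberMeanUpper` (Laplace layer cake + Chebyshev association for the
decreasing slowly varying factor + Gamma moments + threshold arithmetic; Mathlib-only chain `LaplaceLayerCake` / `ChebyshevGamma` /
`TauberWeights` / `TauberMeanUpperPrep` / `TauberMeanUpper`), so this file closes the item by name in one line.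

HONEST FRAMING: a support (real analysis) of a DRAFT-by-design sub-route; the hearts `ToronTubeVolumeLaw` ⟨24497⟩ and `LojasiewiczLocalise`
⟨24498⟩, the leaf ⟨24141⟩ and everything above it are OPEN; no rung / summit statement is proved; the Yang–Mills mass gap is NOT proved.
No `sorry`, no new axiom, no new definition.  References: [cite: Griffiths1964]; [cite: TomboulisYaffe1985].
-/

set_option autoImplicit false

namespace Summit.QuantumFields.YangMills.Theorems.ToronValleyVolume

/-- **`TauberMeanUpper` holds** (item stmt-QuantumFields-24499 of route `ToronValleyVolume`, BY NAME) :=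
✓`VirialFluxGap.TauberMeanUpper.tauberMeanUpper`. [cite: Griffiths1964] [cite: TomboulisYaffe1985] -/
theorem toronValleyVolume_tauberMeanUpper_proof :
    Summit.QuantumFields.YangMills.Theses.ToronValleyVolume.TauberMeanUpper :=
  Summit.QuantumFields.YangMills.Theorems.VirialFluxGap.TauberMeanUpper.tauberMeanUpper

end Summit.QuantumFields.YangMills.Theorems.ToronValleyVolume
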